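import Literature.AlgebraicGeometry.Resolution.AlterationsNormalFormBlowupParts
import Literature.AlgebraicGeometry.Resolution.AlterationsFormalCoordinates
import Literature.AlgebraicGeometry.Resolution.EtaleVanishingIdeal
import Literature.AlgebraicGeometry.Resolution.AdicQuotient
import Literature.AlgebraicGeometry.Resolution.BlowupsProduct
import HarnessLib

/-!
# De Jong's alteration theorem: Claim 4.27 [C2] reduced to the points over the centre

Topic: `Literature/AlgebraicGeometry/Resolution`. Companion to `AlterationsNormalFormBlowupParts.lean`,
which cuts de Jong 1996, Claim 4.27 into the description of the singular locus of the blow-up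
[C1] and the chart computation [C2] = `DeJong1996NormalFormPairBlowupCharts`: for a pair
`(X, Z)` in Situation 4.25 (`DeJong1996.NormalFormPair f Z d`), an irreducible component `E` of
`Sing(X)` and a blow-up `π : X' → X` in the ideal sheaf of `Ē`, the pair `(X', Z' = π⁻¹(Z))`
satisfies the local clauses of 4.25 — `Z'` is the support of an effective Cartier divisor, and
at every closed point `x'` of `X'` the completed local ring with the completed (reduced) ideal
of `Z'` is `(k⟦x₁, …, x_d⟧, (x₁ ⋯ x_r))` (regular points of `Z'`) or
`(k⟦u, v, t₁, …, t_{d-1}⟧/(uv - t₁ ⋯ t_s), (t₁ ⋯ t_r))` (singular points). The printed proof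
("We blow up the scheme `Spec k⟦u, v, t₁, …, t_{d-1}⟧/(uv - t₁ ⋯ t_s)` in the ideal
`(u, v, t₁, t₂)`. We get four charts …", p. 76) is a computation in the completed local rings
at the points of the centre. This file PROVES everything in [C2] that is not that computation
and isolates the computation as a smaller named fact:

* PROVED, `DeJong1996.NormalFormPair.exists_isEffectiveCartier_preimage`: `π⁻¹(Z)` is the
  support of an effective Cartier divisor — the divisor of `Z` pulls back along the blowing up
  (Stacks 0809, `IsEffectiveCartier.comap_of_isBlowup` of `BlowupsProduct.lean`).
* PROVED, the clauses 4.25 (i), (ii) for `(X', π⁻¹(Z))` at the closed points `x'` OFF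
  `π⁻¹(Ē)` (`exists_ringEquiv_of_isRegularLocalRing_of_notMem`,
  `exists_ringEquiv_of_not_isRegularLocalRing_of_notMem`): there `π` is a local isomorphism
  (`IsBlowup.isIso_morphismRestrict`, `isIso_stalkMap_of_isIso_morphismRestrict`), the stalk
  isomorphism `𝒪_{X,π x'} ≅ 𝒪_{X',x'}` extends to the `𝔪`-adic completions
  (`completionEquivOfIsIso`, via `adicCompletionCongr` of `AdicQuotient.lean`) and carries the
  completed stalk ideal of the reduced `Z` to that of the reduced `π⁻¹(Z)`
  (`map_completedStalkIdeal_vanishingIdeal_preimage`: the stalk of `I_{π⁻¹(Z)}` is the radical of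
  the extension of the stalk of `I_Z`, `stalkIdeal_vanishingIdeal_preimage` of
  `StalkIdealLemmas.lean`, and the latter is radical, `isRadical_stalkIdeal_vanishingIdeal` of
  `EtaleVanishingIdeal.lean`); and `π(x')` is a closed point since `π` is
  proper. So 4.25 (i)/(ii) at `π(x')` give 4.25 (i)/(ii) at `x'`.
* NAMED FACT `DeJong1996NormalFormPairBlowupChartsOverCentre` — [C2] at the closed points `x'`
  with `π(x') ∈ Ē`: the printed chart computation proper (to be decomposed further: the ideal
  of `E` in the rings of 4.25 (ii) is `(u, v, t₁, t₂)`; blowing up commutes with completion;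
  the four charts of the blow-up of `Spec k⟦u, v, t⟧/(uv - t₁ ⋯ t_s)` in `(u, v, t₁, t₂)` and
  their closed points; the completion of the reduced preimage is reduced).
* PROVED assembly `DeJong1996NormalFormPairBlowupCharts.of_overCentre`, and the sanity converse
  `DeJong1996NormalFormPairBlowupChartsOverCentre.of_charts`.

## Sources

* A. J. de Jong, *Smoothness, semi-stability and alterations*, Publ. Math. IHÉS 83 (1996) 51–93:
  4.25–4.27 (pp. 75–76). [DeJong1996]
* The Stacks Project, Tag 0809 (effective Cartier divisors pull back along blowing ups), via
  `BlowupsProduct.lean`; Tag 02OS (a blowing up is an isomorphism off its centre), via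
  `Blowups.lean`. [StacksProject]
-/

noncomputable section

open CategoryTheory CategoryTheory.Limits AlgebraicGeometry TopologicalSpace Topology

namespace Literature.AlgebraicGeometry.Resolution

universe u

open IsLocalRing Scheme.IdealSheafData

/-! ## Completed local rings and completed stalk ideals along a local isomorphism -/

section Transfer

variable {X' X : Scheme.{u}} (π : X' ⟶ X) (x' : X') [IsIso (π.stalkMap x')]

/-- The stalk map of `π` at `x'` as a ring isomorphism `𝒪_{X,π x'} ≃ 𝒪_{X',x'}`, when it is an
isomorphism. [folklore] -/
def stalkRingEquivOfIsIso : X.presheaf.stalk (π x') ≃+* X'.presheaf.stalk x' :=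
  (asIso (π.stalkMap x')).commRingCatIsoToRingEquiv

/-- Unfolding `stalkRingEquivOfIsIso`. [folklore] -/
@[simp]
theorem stalkRingEquivOfIsIso_apply (s : X.presheaf.stalk (π x')) :
    stalkRingEquivOfIsIso π x' s = (π.stalkMap x').hom s := rfl

/-- The isomorphism of `𝔪`-adic completions `𝒪̂_{X,π x'} ≃ 𝒪̂_{X',x'}` induced by an isomorphism
of stalks. [folklore] -/
def completionEquivOfIsIso :
    AdicCompletion (maximalIdeal (X.presheaf.stalk (π x'))) (X.presheaf.stalk (π x')) ≃+*
      AdicCompletion (maximalIdeal (X'.presheaf.stalk x')) (X'.presheaf.stalk x') :=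
  adicCompletionCongr _ _ (stalkRingEquivOfIsIso π x')
    (by
      rw [RingEquiv.toRingHom_eq_coe]
      exact IsLocalRing.map_ringEquiv_maximalIdeal (stalkRingEquivOfIsIso π x'))

/-- `completionEquivOfIsIso` extends the stalk map. [folklore] -/
theorem completionEquivOfIsIso_algebraMap (s : X.presheaf.stalk (π x')) :
    completionEquivOfIsIso π x' (algebraMap _ _ s) = algebraMap _ _ ((π.stalkMap x').hom s) := by
  change completionEquivOfIsIso π x' (AdicCompletion.of _ _ s) = AdicCompletion.of _ _ _
  exact adicCompletionCongr_of _ _ _ _ s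

/-- The inverse of `completionEquivOfIsIso` on the image of the stalk map. [folklore] -/
theorem completionEquivOfIsIso_symm_algebraMap (s : X.presheaf.stalk (π x')) :
    (completionEquivOfIsIso π x').symm (algebraMap _ _ ((π.stalkMap x').hom s)) =
      algebraMap _ _ s := by
  rw [← completionEquivOfIsIso_algebraMap, RingEquiv.symm_apply_apply]

/-- **Formal data along a local isomorphism.** If the stalk map of `π` at `x'` is an
isomorphism, the completed stalk ideal of the reduced preimage `π⁻¹(Z)` at `x'` corresponds,
under `completionEquivOfIsIso`, to the completed stalk ideal of `Z` at `π x'`. [folklore] -/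
theorem map_completedStalkIdeal_vanishingIdeal_preimage (Z : Closeds X) (V : X'.affineOpens)
    (hV : x' ∈ (V : X'.Opens)) (U : X.affineOpens) (hU : π x' ∈ (U : X.Opens)) :
    (completedStalkIdeal (vanishingIdeal (Z.preimage π.continuous)) x' V hV).map
        (completionEquivOfIsIso π x').symm.toRingHom =
      completedStalkIdeal (vanishingIdeal Z) (π x') U hU := by
  rw [completedStalkIdeal_eq_map_stalkIdeal, completedStalkIdeal_eq_map_stalkIdeal,
    stalkIdeal_vanishingIdeal_preimage]
  have hsurj : Function.Surjective (π.stalkMap x').hom := (stalkRingEquivOfIsIso π x').surjective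
  have hker : RingHom.ker (π.stalkMap x').hom ≤ stalkIdeal (vanishingIdeal Z) (π x') := by
    have : RingHom.ker (π.stalkMap x').hom = ⊥ := by
      change RingHom.ker (stalkRingEquivOfIsIso π x').toRingHom = ⊥
      exact RingHom.ker_coe_equiv (stalkRingEquivOfIsIso π x')
    rw [this]
    exact bot_le
  rw [← Ideal.map_radical_of_surjective hsurj hker,
    (isRadical_stalkIdeal_vanishingIdeal Z (π x')).radical, Ideal.map_map, Ideal.map_map]
  congr 1
  exact RingHom.ext fun s => completionEquivOfIsIso_symm_algebraMap π x' s

end Transfer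

/-! ## [C2] at the points over the centre, as a named fact -/

/-- NAMED FACT — **de Jong 1996, 4.27 [C2] at the points over the centre.** In the setting of
4.26 (as in `DeJong1996NormalFormPairBlowupCharts`, of which this is the part at the closed
points `x'` of `X'` with `π(x') ∈ Ē` — the only part that needs the chart computation, see
`DeJong1996NormalFormPairBlowupCharts.of_overCentre`): "We blow up the scheme
`Spec k⟦u, v, t₁, …, t_{d-1}⟧/(uv - t₁ ⋯ t_s)` in the ideal `(u, v, t₁, t₂)`. We get four charts
associated to the coordinates `u, v, t₁, t₂`. By symmetry, we need only deal with two of these.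
Chart "`u ≠ 0`". Here we have coordinates `u, v, t₁, …, t_{d-1}, v', t₁', t₂'` and equations
`v = uv'`, `t₁ = ut₁'`, `t₂ = ut₂'` and `v' - t₁'t₂'t₃ ⋯ t_s = 0`. Clearly, this is smooth and
`Z` is given by `u t₁' t₂' t₃ ⋯ t_r = 0`, a normal crossings divisor. Chart "`t₁ ≠ 0`". Here we
have coordinates `u, v, t₁, …, t_{d-1}, u', v', t₂'` and equations `u = t₁u'`, `v = t₁v'`,
`t₂ = t₁t₂'` and `u'v' - t₂' t₃ ⋯ t_s = 0`. The divisor `Z'` is given by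
`t₁ t₂' t₃ ⋯ t_r = 0`. Clearly the singularities are of the type described in (ii)." Rendered:
for every closed point `x'` of `X'` over the centre `Ē`, with `Z' = π⁻¹(Z)` (reduced structure,
`vanishingIdeal`): if `𝒪_{X',x'}` is regular (and `x' ∈ Z'`), then
`(𝒪̂_{X',x'}, Î_{Z'}) ≅ (k⟦x₁, …, x_d⟧, (x₁ ⋯ x_r))` for some `1 ≤ r ≤ d`; if not, then
`(𝒪̂_{X',x'}, Î_{Z'}) ≅ (k⟦u, v, t₁, …, t_{d-1}⟧/(uv - t₁ ⋯ t_s), (t₁ ⋯ t_r))` for some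
`2 ≤ s ≤ r ≤ d - 1`. (The printed computation is formal-local over the closed point `x = π(x')`
of `Ē`, singular on `X`, where 4.25 (ii) and "Since `E` is smooth, its ideal in the rings of
(ii) is given by `(u, v, t₁, t₂)` after renumbering" apply; it uses that blowing up commutes
with completion and that the reduced preimage stays reduced after completion.) Users take
`(h : DeJong1996NormalFormPairBlowupChartsOverCentre)`; it is a node to decompose further.
[cite: DeJong1996, 4.27, p. 76] -/
def DeJong1996NormalFormPairBlowupChartsOverCentre : Prop :=
  ∀ (k : Type u) [Field k] [IsAlgClosed k] (X : Scheme.{u}) (f : X ⟶ Spec (.of k)) (Z : Set X)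
    (d : ℕ) (h : DeJong1996.NormalFormPair f Z d),
      ∀ E ∈ irreducibleComponents
          ↥({x : X | ¬ IsRegularLocalRing (X.presheaf.stalk x)} : Set X),
        ∀ (X' : Scheme.{u}) (π : X' ⟶ X),
          IsBlowup π (Scheme.IdealSheafData.vanishingIdeal
            ⟨closure (Subtype.val '' E), isClosed_closure⟩) →
            Literature.AlgebraicGeometry.Motives.IsProjectiveOver (Over.mk (π ≫ f)) →
              (∀ x : X', IsClosed ({x} : Set X') → IsRegularLocalRing (X'.presheaf.stalk x) →
                x ∈ π ⁻¹' Z → π x ∈ closure (Subtype.val '' E) →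
                  ∃ r : ℕ, 1 ≤ r ∧ r ≤ d ∧
                    ∃ e : AdicCompletion (maximalIdeal (X'.presheaf.stalk x))
                        (X'.presheaf.stalk x) ≃+* MvPowerSeries (Fin d) k,
                      ∀ (U : X'.affineOpens) (hU : x ∈ (U : X'.Opens)),
                        (completedStalkIdeal (Scheme.IdealSheafData.vanishingIdeal
                            ⟨π ⁻¹' Z, h.isClosed.preimage π.continuous⟩) x U hU).map
                          e.toRingHom =
                          Ideal.span {DeJong1996.normalCrossingsEquation k d r}) ∧
              ∀ x : X', IsClosed ({x} : Set X') → ¬ IsRegularLocalRing (X'.presheaf.stalk x) →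
                π x ∈ closure (Subtype.val '' E) →
                  ∃ s r : ℕ, 2 ≤ s ∧ s ≤ r ∧ r ≤ d - 1 ∧
                    ∃ e : AdicCompletion (maximalIdeal (X'.presheaf.stalk x))
                        (X'.presheaf.stalk x) ≃+* DeJong1996.NodalFamilyRing k (d - 1) s,
                      ∀ (U : X'.affineOpens) (hU : x ∈ (U : X'.Opens)),
                        (completedStalkIdeal (Scheme.IdealSheafData.vanishingIdeal
                            ⟨π ⁻¹' Z, h.isClosed.preimage π.continuous⟩) x U hU).map
                          e.toRingHom =
                          Ideal.span {DeJong1996.nodalFamilyBoundary k (d - 1) s r}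

/-! ## [C2] off the centre, proved -/

namespace DeJong1996.NormalFormPair

variable {k : Type u} [Field k] {X X' : Scheme.{u}} {f : X ⟶ Spec (.of k)} {Z : Set X} {d : ℕ}
  {π : X' ⟶ X}

/-- **`Z' = π⁻¹(Z)` is (the support of) a divisor**: the effective Cartier divisor with support
`Z` (4.25) pulls back along the blow-up `π` to an effective Cartier divisor with support
`π⁻¹(Z)` (Stacks 0809, `IsEffectiveCartier.comap_of_isBlowup`).
[cite: DeJong1996, 4.27, p. 76] -/
theorem exists_isEffectiveCartier_preimage (h : NormalFormPair f Z d) {J : X.IdealSheafData}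
    (hπ : IsBlowup π J) :
    ∃ I : X'.IdealSheafData, IsEffectiveCartier I ∧ (I.support : Set X') = π ⁻¹' Z := by
  obtain ⟨I, hI, hIZ⟩ := h.exists_isEffectiveCartier
  refine ⟨I.comap π, hI.comap_of_isBlowup hπ, ?_⟩
  rw [support_comap, Closeds.coe_preimage, hIZ]

/-- A proper morphism maps closed points to closed points. [folklore] -/
theorem isClosed_singleton_apply [IsProper π] {x' : X'} (hx' : IsClosed ({x'} : Set X')) :
    IsClosed ({π x'} : Set X) := by
  have := π.isClosedMap _ hx'
  rwa [Set.image_singleton] at this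

/-- **4.25 (i) for `(X', π⁻¹(Z))` at the closed points off the centre.** Off `π⁻¹(C)` the
blow-up `π` of `X` in the ideal sheaf of the closed `C` induces isomorphisms of local rings
(`IsBlowup.isIso_morphismRestrict`), hence of their completions, carrying the completed stalk
ideal of `Z` to that of `π⁻¹(Z)` (`map_completedStalkIdeal_vanishingIdeal_preimage`); and `π`
is proper, so a closed point `x'` lies over a closed point. So 4.25 (i) at `π(x')` gives 4.25
(i) at `x'`. [cite: DeJong1996, 4.25–4.27, pp. 75–76] -/
theorem exists_ringEquiv_of_isRegularLocalRing_of_notMem (h : NormalFormPair f Z d)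
    (C : Closeds X) (hπ : IsBlowup π (vanishingIdeal C)) {x' : X'}
    (hx'c : IsClosed ({x'} : Set X')) (hreg : IsRegularLocalRing (X'.presheaf.stalk x'))
    (hx'Z : x' ∈ π ⁻¹' Z) (hx' : π x' ∉ C) :
    ∃ r : ℕ, 1 ≤ r ∧ r ≤ d ∧
      ∃ e : AdicCompletion (maximalIdeal (X'.presheaf.stalk x')) (X'.presheaf.stalk x') ≃+*
          MvPowerSeries (Fin d) k,
        ∀ (U : X'.affineOpens) (hU : x' ∈ (U : X'.Opens)),
          (completedStalkIdeal (vanishingIdeal ⟨π ⁻¹' Z, h.isClosed.preimage π.continuous⟩)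
              x' U hU).map e.toRingHom =
            Ideal.span {normalCrossingsEquation k d r} := by
  haveI := h.isIntegral
  haveI := h.locallyOfFiniteType
  haveI : IsNoetherian X := h.isNoetherian
  haveI : IsProper π := hπ.isProper
  haveI : IsIso (π ∣_ ⟨(C : Set X)ᶜ, C.isClosed.isOpen_compl⟩) :=
    isIso_morphismRestrict_compl_of_isBlowup C hπ
  haveI : IsIso (π.stalkMap x') :=
    isIso_stalkMap_of_isIso_morphismRestrict π ⟨(C : Set X)ᶜ, C.isClosed.isOpen_compl⟩ x' hx'
  have hxc : IsClosed ({π x'} : Set X) := isClosed_singleton_apply hx'c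
  have hxreg : IsRegularLocalRing (X.presheaf.stalk (π x')) :=
    IsRegularLocalRing.of_ringEquiv (stalkRingEquivOfIsIso π x').symm
  obtain ⟨r, hr1, hrd, e, he⟩ := h.exists_ringEquiv_of_isRegularLocalRing (π x') hxc hxreg hx'Z
  refine ⟨r, hr1, hrd, (completionEquivOfIsIso π x').symm.trans e, fun U hU => ?_⟩
  obtain ⟨U₀, hU₀, hxU₀, -⟩ :=
    exists_isAffineOpen_mem_and_subset (X := X) (x := π x') (U := ⊤) (Opens.mem_top _)
  rw [show ((completionEquivOfIsIso π x').symm.trans e).toRingHom =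
      e.toRingHom.comp (completionEquivOfIsIso π x').symm.toRingHom from rfl, ← Ideal.map_map,
    ← he ⟨U₀, hU₀⟩ hxU₀,
    ← map_completedStalkIdeal_vanishingIdeal_preimage π x' ⟨Z, h.isClosed⟩ U hU ⟨U₀, hU₀⟩ hxU₀]
  rfl

/-- **4.25 (ii) for `(X', π⁻¹(Z))` at the closed points off the centre**, likewise from 4.25
(ii) at `π(x')`. [cite: DeJong1996, 4.25–4.27, pp. 75–76] -/
theorem exists_ringEquiv_of_not_isRegularLocalRing_of_notMem (h : NormalFormPair f Z d)
    (C : Closeds X) (hπ : IsBlowup π (vanishingIdeal C)) {x' : X'}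
    (hx'c : IsClosed ({x'} : Set X')) (hsing : ¬ IsRegularLocalRing (X'.presheaf.stalk x'))
    (hx' : π x' ∉ C) :
    ∃ s r : ℕ, 2 ≤ s ∧ s ≤ r ∧ r ≤ d - 1 ∧
      ∃ e : AdicCompletion (maximalIdeal (X'.presheaf.stalk x')) (X'.presheaf.stalk x') ≃+*
          NodalFamilyRing k (d - 1) s,
        ∀ (U : X'.affineOpens) (hU : x' ∈ (U : X'.Opens)),
          (completedStalkIdeal (vanishingIdeal ⟨π ⁻¹' Z, h.isClosed.preimage π.continuous⟩)
              x' U hU).map e.toRingHom =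
            Ideal.span {nodalFamilyBoundary k (d - 1) s r} := by
  haveI := h.isIntegral
  haveI := h.locallyOfFiniteType
  haveI : IsNoetherian X := h.isNoetherian
  haveI : IsProper π := hπ.isProper
  haveI : IsIso (π ∣_ ⟨(C : Set X)ᶜ, C.isClosed.isOpen_compl⟩) :=
    isIso_morphismRestrict_compl_of_isBlowup C hπ
  haveI : IsIso (π.stalkMap x') :=
    isIso_stalkMap_of_isIso_morphismRestrict π ⟨(C : Set X)ᶜ, C.isClosed.isOpen_compl⟩ x' hx'
  have hxc : IsClosed ({π x'} : Set X) := isClosed_singleton_apply hx'c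
  have hxsing : ¬ IsRegularLocalRing (X.presheaf.stalk (π x')) := fun hr =>
    hsing (IsRegularLocalRing.of_ringEquiv (stalkRingEquivOfIsIso π x'))
  obtain ⟨s, r, hs2, hsr, hrd, e, he⟩ :=
    h.exists_ringEquiv_of_not_isRegularLocalRing (π x') hxc hxsing
  refine ⟨s, r, hs2, hsr, hrd, (completionEquivOfIsIso π x').symm.trans e, fun U hU => ?_⟩
  obtain ⟨U₀, hU₀, hxU₀, -⟩ :=
    exists_isAffineOpen_mem_and_subset (X := X) (x := π x') (U := ⊤) (Opens.mem_top _)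
  rw [show ((completionEquivOfIsIso π x').symm.trans e).toRingHom =
      e.toRingHom.comp (completionEquivOfIsIso π x').symm.toRingHom from rfl, ← Ideal.map_map,
    ← he ⟨U₀, hU₀⟩ hxU₀,
    ← map_completedStalkIdeal_vanishingIdeal_preimage π x' ⟨Z, h.isClosed⟩ U hU ⟨U₀, hU₀⟩ hxU₀]
  rfl

end DeJong1996.NormalFormPair

/-! ## The assembly -/

/-- **`DeJong1996NormalFormPairBlowupCharts` ([C2] of Claim 4.27) from its part over the
centre.** `Z' = π⁻¹(Z)` is the support of the pulled-back effective Cartier divisor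
(`exists_isEffectiveCartier_preimage`); at a closed point `x'` off `π⁻¹(Ē)` the blow-up does not
change the local ring, its completion or the completed ideal of the boundary, and `π(x')` is a
closed point of `X`, so 4.25 (i)/(ii) at `x'` are 4.25 (i)/(ii) at `π(x')`
(`exists_ringEquiv_of_isRegularLocalRing_of_notMem`,
`exists_ringEquiv_of_not_isRegularLocalRing_of_notMem`); at the closed points over `Ē` they
are the chart computation `DeJong1996NormalFormPairBlowupChartsOverCentre`.
[cite: DeJong1996, 4.27, p. 76] -/
theorem DeJong1996NormalFormPairBlowupCharts.of_overCentre
    (H : DeJong1996NormalFormPairBlowupChartsOverCentre.{u}) :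
    DeJong1996NormalFormPairBlowupCharts.{u} := by
  intro k _ _ X f Z d h E hE X' π hπ hproj
  obtain ⟨hi, hii⟩ := H k X f Z d h E hE X' π hπ hproj
  refine ⟨h.exists_isEffectiveCartier_preimage hπ, fun x' hx'c hreg hx'Z => ?_,
    fun x' hx'c hsing => ?_⟩
  · by_cases hx : π x' ∈ closure (Subtype.val '' E)
    · exact hi x' hx'c hreg hx'Z hx
    · exact h.exists_ringEquiv_of_isRegularLocalRing_of_notMem
        ⟨closure (Subtype.val '' E), isClosed_closure⟩ hπ hx'c hreg hx'Z hx
  · by_cases hx : π x' ∈ closure (Subtype.val '' E)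
    · exact hii x' hx'c hsing hx
    · exact h.exists_ringEquiv_of_not_isRegularLocalRing_of_notMem
        ⟨closure (Subtype.val '' E), isClosed_closure⟩ hπ hx'c hsing hx

/-! ## Sanity of the cut -/

/-- Sanity of the cut: [C2] gives back its part over the centre (forget the hypothesis
`π(x') ∈ Ē`). [folklore] -/
theorem DeJong1996NormalFormPairBlowupChartsOverCentre.of_charts
    (H : DeJong1996NormalFormPairBlowupCharts.{u}) :
    DeJong1996NormalFormPairBlowupChartsOverCentre.{u} := by
  intro k _ _ X f Z d h E hE X' π hπ hproj
  obtain ⟨-, hi, hii⟩ := H k X f Z d h E hE X' π hπ hproj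
  exact ⟨fun x' hx'c hreg hx'Z _ => hi x' hx'c hreg hx'Z, fun x' hx'c hsing _ => hii x' hx'c hsing⟩

end Literature.AlgebraicGeometry.Resolution

end
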